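/-
Copyright (c) 2026 the pub-hodgecm-mathlib formalisation cell (harness21).  Prover seat hodgecm-mathlib-F0P2-p09 (g2), Track B «K2-LIT»,
#184♮ = hLiu418 = `stmt-HodgeConjecture-24832`; socket #41, KIND 1 (K1-b♮), organ (K1b-W) «KIND W AT `n := 1` FOR THE PULLED-BACK FAMILY»,
brick (KW1-b2′) — LEAD F0P6-plan (g14) BATCH #121 (3) (line lead K2Liu-p14 (g4), LINE WORD #5).  THEOREMS ONLY (no `def`, no `instance`, no notation,
no named-fact hypothesis, no `sorry`).
-/
import Summits.HodgeConjecture.HodgeConjecture.Theorems.K2LiuLocalWhittakerFactorSkew          -- ★ B4 (`map_adeleEval_map_algebraMap`; brings ★ (d1) `unipDeltaChar_locToAdelic_eq_prod`, ★ B1 `trace_mul_toBlocks₁₂_component_nElem`, `unipDeltaChar`, `locToAdelic`)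
import Summits.HodgeConjecture.HodgeConjecture.Theorems.K2LiuUnipDeltaRankOneCoordinates       -- ★ O41.5c rank one: `skew_coord`, `conjLocal_coord`
import Literature.NumberTheory.GelbartRogawski1991.DoubledWeilRepresentationArchLagrangian    -- ★ `isUnit_det_gramR₀`
import Literature.NumberTheory.GelbartRogawski1991.LocalDoubledUnitaryGoodPlace               -- ★ `valuation_eq_one_iff_valued`
import Literature.NumberTheory.Automorphic.RamifiedPlaceResidueFieldBridge                    -- ★ `valued_toPlace_eq_one_iff` (`|ι_w y|_w = 1 ↔ |y|_v = 1`)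
import Literature.NumberTheory.Automorphic.TateLocalZetaShells                                -- ★ `normAbs_eq_one_iff_valuation_eq_one`
import HarnessLib

/-!
# Crux `HLiu418`, socket #41, KIND 1 ∕ organ (K1b-W), brick (KW1-b2′): THE COORDINATE READING OF THE TWIST —
# `conj ψ_S(ι_v n(ι_v b·δ)) = ψ_v(b·ξ)`, `ξ = Tr(⅟2·S₀₀·δ)`, and `|ξ|_v = 1` for a skew unimodular line index

Cell `hodgecm-mathlib`, crux item hLiu418 = `stmt-HodgeConjecture-24832` (helper lane `--supports … --as helper`, count-neutral), route of record
`HCCMUnconditional`; squad K2 ∕ K2Liu, road `K2_Liu`, socket #41 `sig_K2LiuSiegelEisensteinContinuation`, KIND 1, organ (K1b-W) (line lead K2Liu-p14 (g4)).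
THE LETTERS PAID.  ★ (KW1-b2) `K2LiuKindOneLineGoodPlaceFactor.integral_conj_unipDeltaChar_mul_lambdaLoc_weylDelta_eq` (K2Liu-p14 (g4)) — the RANK-ONE
good-place letter `hJ₁` of ★ p862675 (KW1-b) — takes BY VALUE the COORDINATE READING of the twisting character on the doubled LINE `N_Δ(L⁺_v) ≅ L⁺_v`,
`hread : ∀ b, conj ψ_S(ι_v n(ι_v b·δ)) = ψ(b·ξ)`, for a continuous `ψ : AddChar L⁺_v 𝕊¹` and SOME `ξ ∈ L⁺_v` with `hξ : |ξ|_v = 1`.  THIS FILE discharges both for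
Tate's local character — i.e. for ANY `ψ` and local trace `τ : L ⊗ L⁺_v → L⁺_v` with the letters of ★ B3 ∕ ★ `K2LiuGoodPlaceLocalFactor`
(`hτ : ι_v(τ r) = r + σr`, `hτs : τ(ι_v z·r) = z·τ r`, `hΨ : ∏_{w∣v} ψ_{L,w}(x_w) = ψ(τ x)`) — with the EXPLICIT
  **`ξ := τ(⅟2 · (S₀₀ ⊗ 1) · (δ ⊗ 1))`**, `δ = imagUnit L`.
THE ALGEBRA ([Shimura1997, §18.1 (18.4)], [Tate1950, §2.2], [Weil1964, §14]).  At `y = n(t)`, `t = [ι_v b·δ]` (a `1 × 1` skew matrix, ★ `skew_coord`), ★ (d1)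
`unipDeltaChar_locToAdelic_eq_prod` and ★ B1 `trace_mul_toBlocks₁₂_component_nElem` give `ψ_S(ι_v y) = ∏_w ψ_{L,w}(−(⅟2)_w · tr((S ⊗ 1)·t)_w) = ψ(τ x)` with
`x = −⅟2·(S₀₀⊗1)·ι_v b·δ` (★ B4 §2∕§3 verbatim at `n = 1`); `conj ψ(τ x) = ψ(−τ x) = ψ(τ(−x))` and `hτs` pulls the scalar `b` out: `ψ(b·ξ)`.  For the UNIT: `hτ` reads
`ι_v ξ = r + σ r` with `r = ⅟2·(S₀₀⊗1)(δ⊗1)`; when the line index is SKEW (`σ S₀₀ = −S₀₀` — the rank-one Skew condition, ★ `skew_iff_conjLocal_apply_eq_neg`; `σ δ = −δ`)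
`σ r = r`, so `ι_v ξ = 2·r = (S₀₀ δ) ⊗ 1` (the `½` cancels the `2` of the trace EXACTLY — no `|2|_w = 1` needed), whence `|ι_w ξ|_w = |S₀₀|_w · |δ|_w = 1` at a place where
`S₀₀` and `δ` are `w`-units, and `|ξ|_v = 1` (★ `valued_toPlace_eq_one_iff`).
* §1 **`conj_unipDeltaChar_coord_eq`** — the reading, in ★ (KW1-b2)'s `hread` binder BYTES (`hread := conj_unipDeltaChar_coord_eq … S`).
* §2 **`normAbs_xi_eq_one`** — `|ξ|_v = 1` from `σ S₀₀ = −S₀₀`, `|S₀₀|_w = 1`, `|δ|_w = 1` at one `w ∣ v` (★ (KW1-b2)'s `hδw` shape);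
  **`normAbs_xi_eq_one_of_integral`** — the same from the off-`U(S,h)` letters of ★ (x-a) `K2LiuSiegelEisensteinKindWLetters` §1 (`S` and `S⁻¹` integral above `v`,
  ★ `integral_of_not_mem_kindWPlaces` ∕ `inv_integral_of_not_mem_kindWPlaces` shapes) and `S₀₀ ≠ 0`.
[Shimura1997, §18.1 (18.4)] [Tate1950, §2.2] [Weil1964, §14] [HarrisKudlaSweet1996, §1 (1.12)] [CasselsFrohlichANT1967, Ch. II §10, Ch. XV §2.2].
HONEST LABEL.  Count-neutral helper; closes no socket by itself; `HC_CM` is proved only modulo the 7 printed citations (2 remaining named inputs: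
hLiu418 = `stmt-HodgeConjecture-24832`, h413 = `stmt-HodgeConjecture-24833`) until rung 0 closes.  NOT HERE: the existence of `(ψ, τ)` with the letters
`hτ hτs hΨ` (Tate's local trace compatibility, ★ B3 `K2LiuTateCharacterLocalTrace`), taken by value exactly as ★ `K2LiuGoodPlaceLocalFactor` does.

## References
* [Shimura1997] G. Shimura, *Euler products and Eisenstein series*, CBMS 93 (1997): §18.1 (18.4) (the character of the Siegel unipotent radical).
* [Tate1950] J. Tate, thesis (1950), in Cassels–Fröhlich (1967) Ch. XV: §2.2 (local additive characters and the trace).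
* [Weil1964] A. Weil, *Sur certains groupes d'opérateurs unitaires*, Acta Math. 111 (1964): §14.
* [HarrisKudlaSweet1996] M. Harris, S. Kudla, W. J. Sweet, J. AMS 9 (1996): §1 (1.11)–(1.12).
* [CasselsFrohlichANT1967] J. W. S. Cassels, A. Fröhlich (eds.), *Algebraic Number Theory* (1967): Ch. II §10 (`L ⊗ K_v = ∏ L_w`).
-/

set_option autoImplicit false
-- the mandated namespace repeats the single-problem summit's segment (`HodgeConjecture.HodgeConjecture`)
set_option linter.dupNamespace false

noncomputable section

open scoped Matrix ComplexConjugate NNReal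
open NumberField IsDedekindDomain Matrix
open Literature.NumberTheory.Automorphic Literature.NumberTheory.Automorphic.UnitaryGroup Literature.NumberTheory.GaloisRepresentations
open Literature.NumberTheory.GaloisRepresentations.IsNonarchimedeanLocalField
open Literature.NumberTheory.GelbartRogawski1991 Literature.NumberTheory.GelbartRogawski1991.GRConstruction
open Literature.NumberTheory.GelbartRogawski1991.AdaptedBlocks
open Literature.NumberTheory.GelbartRogawski1991.UnitaryDualPair Literature.NumberTheory.GelbartRogawski1991.UnitaryDualPair.LocalSplitting
open Literature.NumberTheory.K2Lit Literature.NumberTheory.K2Lit.SiegelDoubled Literature.NumberTheory.K2Lit.LocalSiegelDoubled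
open Summit.HodgeConjecture.HodgeConjecture.Cruxes.HLiu418.K2LiuSiegelUnipotentFourierDefs
open Summit.HodgeConjecture.HodgeConjecture.Cruxes.HLiu418.K2LiuSiegelUnipotentLocalDefs
open Summit.HodgeConjecture.HodgeConjecture.Cruxes.HLiu418.K2LiuSiegelUnipotentCharacterFactorisation
open Summit.HodgeConjecture.HodgeConjecture.Cruxes.HLiu418.K2LiuUnipDeltaLocBridge
open Summit.HodgeConjecture.HodgeConjecture.Cruxes.HLiu418.K2LiuUnipDeltaLocalCoordinates
open Summit.HodgeConjecture.HodgeConjecture.Cruxes.HLiu418.K2LiuUnipDeltaRankOneCoordinates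
open Summit.HodgeConjecture.HodgeConjecture.Cruxes.HLiu418.K2LiuLocalWhittakerFactorSkew

namespace Summit.HodgeConjecture.HodgeConjecture.Cruxes.HLiu418.K2LiuKindOneLineCharacterReading

variable (L : Type) [Field L] [NumberField L] [IsCMField L]
variable {N M : ℕ} (e : Fin N × Fin M ≃ Fin 1)
  (dV : Fin N → L) (hdV : ∀ i, IsCMField.complexConj L (dV i) = dV i) (hdV0 : ∀ i, dV i ≠ 0)
  (dW : Fin M → L) (hdW : ∀ i, IsCMField.complexConj L (dW i) = dW i) (hdW0 : ∀ i, dW i ≠ 0)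
  (v : HeightOneSpectrum (𝓞 (Fp L)))

/-! ## §1 The coordinate reading of the twist on the doubled line -/

include hdV0 hdW0 in

/-- **THE COORDINATE READING OF THE TWIST** — ★ (KW1-b2)'s `hread` letter, PAID: for the Fourier index `S ∈ M₁(L)`, any additive character `ψ` of `L⁺_v` and any
local trace `τ : L ⊗ L⁺_v → L⁺_v` with `τ(ι_v z · r) = z · τ r` (`hτs`) and Tate's compatibility `∏_{w∣v} ψ_{L,w}(x_w) = ψ(τ x)` (`hΨ`, ★ B3's letter), and every `b ∈ L⁺_v`,
`conj ψ_S(ι_v n(ι_v b · δ)) = ψ(b · ξ)` with **`ξ = τ(⅟2 · (S₀₀ ⊗ 1) · (δ ⊗ 1))`** (`δ = imagUnit L`; ★ (d1) `unipDeltaChar_locToAdelic_eq_prod` + ★ B1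
`trace_mul_toBlocks₁₂_component_nElem`, then `conj ψ(a) = ψ(−a)` and `hτs`).
[cite: Shimura1997, §18.1 (18.4)] [cite: Tate1950, §2.2] [cite: HarrisKudlaSweet1996, §1 (1.12)] -/
theorem conj_unipDeltaChar_coord_eq
    {ψ : AddChar (v.adicCompletion (Fp L)) Circle} {τ : LocalRing L v → v.adicCompletion (Fp L)}
    (hτs : ∀ (z : v.adicCompletion (Fp L)) (r : LocalRing L v), τ (toLocalRing L v z * r) = z * τ r)
    (hΨ : ∀ x : LocalRing L v, (∏ w : UnitaryGroup.PlacesOver L v, (adeleAddChar L).adicComponent w.1 (x w)) = ψ (τ x))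
    (S : Matrix (Fin 1) (Fin 1) L) :
    haveI : Algebra.IsQuadraticExtension (Fp L) L := IsCMField.isQuadraticExtension L
    ∀ b : v.adicCompletion (Fp L),
      conj ((unipDeltaChar L e dV hdV dW hdW S (locToAdelic L e dV hdV dW hdW v
        (nElem (Fp L) L (IsCMField.complexConj L) v 1 (hermD_eq_map_gramD L e dV hdV dW hdW)
          (Matrix.of fun _ _ : Fin 1 => toLocalRing L v b * algebraMap L (LocalRing L v) (imagUnit L))
          (skew_coord (Fp L) L (IsCMField.complexConj L) (complexConj_imagUnit L) v (isUnit_det_gramR₀ L e dV hdV hdV0 dW hdW hdW0) b))) : Circle) : ℂ) =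
        ((ψ (b * τ (⅟(2 : LocalRing L v) * algebraMap L (LocalRing L v) (S 0 0) * algebraMap L (LocalRing L v) (imagUnit L))) : Circle) : ℂ) := by
  haveI : Algebra.IsQuadraticExtension (Fp L) L := IsCMField.isQuadraticExtension L
  intro b
  -- the character at `y = n(t)` as a product over the places above `v` (★ (d1) + ★ B1, as ★ B4 §2 `hchar`)
  have ht := skew_coord (Fp L) L (IsCMField.complexConj L) (complexConj_imagUnit L) v (isUnit_det_gramR₀ L e dV hdV hdV0 dW hdW hdW0) b
  have hchar : unipDeltaChar L e dV hdV dW hdW S (locToAdelic L e dV hdV dW hdW v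
      (nElem (Fp L) L (IsCMField.complexConj L) v 1 (hermD_eq_map_gramD L e dV hdV dW hdW)
        (Matrix.of fun _ _ : Fin 1 => toLocalRing L v b * algebraMap L (LocalRing L v) (imagUnit L)) ht)) =
      ∏ w : UnitaryGroup.PlacesOver L v, (adeleAddChar L).adicComponent w.1
        (-((⅟(2 : LocalRing L v)) w * (Matrix.trace (S.map (algebraMap L (LocalRing L v)) *
          (Matrix.of fun _ _ : Fin 1 => toLocalRing L v b * algebraMap L (LocalRing L v) (imagUnit L)))) w)) := by
    rw [unipDeltaChar_locToAdelic_eq_prod]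
    refine Finset.prod_congr rfl fun w _ => ?_
    rw [map_adeleEval_map_algebraMap L v S w,
      trace_mul_toBlocks₁₂_component_nElem (Fp L) L (IsCMField.complexConj L) v 1 (hermD_eq_map_gramD L e dV hdV dW hdW) ht w]
  -- bundle the places through the local trace (★ B4 §3 `hprod`)
  set x : LocalRing L v := -(⅟(2 : LocalRing L v) * Matrix.trace (S.map (algebraMap L (LocalRing L v)) *
    (Matrix.of fun _ _ : Fin 1 => toLocalRing L v b * algebraMap L (LocalRing L v) (imagUnit L)))) with hx
  have hprod : (∏ w : UnitaryGroup.PlacesOver L v, (adeleAddChar L).adicComponent w.1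
      (-((⅟(2 : LocalRing L v)) w * (Matrix.trace (S.map (algebraMap L (LocalRing L v)) *
        (Matrix.of fun _ _ : Fin 1 => toLocalRing L v b * algebraMap L (LocalRing L v) (imagUnit L)))) w))) = ψ (τ x) := by
    rw [← hΨ x]
    refine Finset.prod_congr rfl fun w _ => ?_
    rw [hx, Pi.neg_apply, Pi.mul_apply]
  -- `−x = ι_v b · (⅟2 · (S₀₀ ⊗ 1) · (δ ⊗ 1))` (the trace of a `1 × 1` matrix is its entry)
  have hnegx : -x = toLocalRing L v b * (⅟(2 : LocalRing L v) * algebraMap L (LocalRing L v) (S 0 0) * algebraMap L (LocalRing L v) (imagUnit L)) := by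
    rw [hx, neg_neg, Matrix.trace_fin_one, Matrix.mul_apply, Fin.sum_univ_one, Matrix.map_apply, Matrix.of_apply]
    ring
  -- `τ(−x) = −τ x` (from `hτs` at `z = −1`) and `τ(ι_v b · r) = b · τ r`
  have hneg : τ (-x) = -τ x := by
    have h := hτs (-1) x
    rwa [map_neg, map_one, neg_one_mul, neg_one_mul] at h
  rw [hchar, hprod, ← Circle.coe_inv_eq_conj, ← AddChar.map_neg_eq_inv, ← hneg, hnegx, hτs]

/-! ## §2 The unit `ξ`: `|ξ|_v = 1` for a skew line index unimodular above `v` -/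

omit [IsCMField L] in
/-- `⅟2 = ι_v(2⁻¹)` in `L ⊗ L⁺_v` (characteristic `0`). [folklore] -/
theorem invOf_two_eq_toLocalRing : ⅟(2 : LocalRing L v) = toLocalRing L v (2⁻¹ : v.adicCompletion (Fp L)) := by
  haveI : CharZero (v.adicCompletion (Fp L)) := charZero_of_injective_algebraMap (algebraMap (Fp L) (v.adicCompletion (Fp L))).injective
  refine invOf_eq_right_inv ?_
  rw [← map_ofNat (toLocalRing L v) 2, ← map_mul, mul_inv_cancel₀ (two_ne_zero' (v.adicCompletion (Fp L))), map_one]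

/-- **`ι_v ξ = (S₀₀ δ) ⊗ 1` FOR A SKEW LINE INDEX**: with `hτ : ι_v(τ r) = r + σ r`, `σ S₀₀ = −S₀₀` and `σ δ = −δ`, the element `r = ⅟2·(S₀₀⊗1)(δ⊗1)` is `σ`-fixed, so
`ι_v ξ = 2r = (S₀₀ ⊗ 1)(δ ⊗ 1)` — the `½` cancels the `2` of the trace. [cite: CasselsFrohlichANT1967, Ch. II §10] [cite: Shimura1997, §18.1 (18.4)] -/
theorem toLocalRing_xi_eq {τ : LocalRing L v → v.adicCompletion (Fp L)}
    (hτ : ∀ r, toLocalRing L v (τ r) = r + conjLocal L (IsCMField.complexConj L) v r)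
    (S : Matrix (Fin 1) (Fin 1) L) (hSσ : IsCMField.complexConj L (S 0 0) = -S 0 0) :
    toLocalRing L v (τ (⅟(2 : LocalRing L v) * algebraMap L (LocalRing L v) (S 0 0) * algebraMap L (LocalRing L v) (imagUnit L))) =
      algebraMap L (LocalRing L v) (S 0 0) * algebraMap L (LocalRing L v) (imagUnit L) := by
  have hfix : conjLocal L (IsCMField.complexConj L) v (⅟(2 : LocalRing L v) * algebraMap L (LocalRing L v) (S 0 0) * algebraMap L (LocalRing L v) (imagUnit L)) =
      ⅟(2 : LocalRing L v) * algebraMap L (LocalRing L v) (S 0 0) * algebraMap L (LocalRing L v) (imagUnit L) := by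
    rw [map_mul, map_mul, conjLocal_algebraMap, conjLocal_algebraMap, hSσ, complexConj_imagUnit, map_neg, map_neg, invOf_two_eq_toLocalRing,
      conjLocal_toLocalRing]
    ring
  rw [hτ, hfix, ← two_mul, ← mul_assoc, ← mul_assoc, mul_invOf_self', one_mul]

omit [IsCMField L] in
/-- the `w`-component of `x ⊗ 1 ∈ L ⊗ L⁺_v` is `x ∈ L_w`. [folklore] -/
theorem algebraMap_localRing_apply (x : L) (w : UnitaryGroup.PlacesOver L v) :
    algebraMap L (LocalRing L v) x w = ((x : L) : w.1.adicCompletion L) := by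
  rw [Pi.algebraMap_apply, HeightOneSpectrum.algebraMap_adicCompletion, Function.comp_apply, Algebra.algebraMap_self, RingHom.id_apply]

/-- **`|ξ|_v = 1`** — ★ (KW1-b2)'s `hξ` letter, PAID for a SKEW line index (`σ S₀₀ = −S₀₀`) whose entry is a `w`-unit at some `w ∣ v` where `δ` is a `w`-unit
(`ι_v ξ = (S₀₀ δ) ⊗ 1`, so `|ι_w ξ|_w = |S₀₀|_w·|δ|_w = 1`, and `|ι_w ξ|_w = 1 ↔ |ξ|_v = 1`, ★ `valued_toPlace_eq_one_iff`).
[cite: CasselsFrohlichANT1967, Ch. II §10] [cite: Tate1950, §2.2] -/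
theorem normAbs_xi_eq_one {τ : LocalRing L v → v.adicCompletion (Fp L)}
    (hτ : ∀ r, toLocalRing L v (τ r) = r + conjLocal L (IsCMField.complexConj L) v r)
    (S : Matrix (Fin 1) (Fin 1) L) (hSσ : IsCMField.complexConj L (S 0 0) = -S 0 0)
    (w : UnitaryGroup.PlacesOver L v) (hSw : Valued.v ((S 0 0 : L) : w.1.adicCompletion L) = 1)
    (hδw : Valued.v ((imagUnit L : L) : w.1.adicCompletion L) = 1) :
    normAbs (v.adicCompletion (Fp L)) (τ (⅟(2 : LocalRing L v) * algebraMap L (LocalRing L v) (S 0 0) * algebraMap L (LocalRing L v) (imagUnit L))) = 1 := by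
  have hw : Valued.v (toPlace v w (τ (⅟(2 : LocalRing L v) * algebraMap L (LocalRing L v) (S 0 0) * algebraMap L (LocalRing L v) (imagUnit L)))) = 1 := by
    rw [← toLocalRing_apply L v _ w, toLocalRing_xi_eq L v hτ S hSσ, Pi.mul_apply, map_mul, algebraMap_localRing_apply L v (S 0 0) w,
      algebraMap_localRing_apply L v (imagUnit L) w, hSw, hδw, mul_one]
  exact normAbs_eq_one_iff_valuation_eq_one.2 ((valuation_eq_one_iff_valued (Fp L) v _).2 ((valued_toPlace_eq_one_iff L v w _).1 hw))

omit [NumberField L] [IsCMField L] in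
/-- the `(0,0)` entry of the inverse of a `1 × 1` matrix over a field is the inverse of the entry. [folklore] -/
theorem inv_fin_one_apply (S : Matrix (Fin 1) (Fin 1) L) : S⁻¹ 0 0 = (S 0 0)⁻¹ := by
  rw [Matrix.inv_def, Matrix.det_fin_one, Matrix.adjugate_fin_one, Matrix.smul_apply, Matrix.one_apply_eq, smul_eq_mul, mul_one, Ring.inverse_eq_inv]

omit [IsCMField L] in
/-- a field element that is `w`-integral together with its inverse is a `w`-unit. [folklore] -/
theorem valued_coe_eq_one_of_integral (w : HeightOneSpectrum (𝓞 L)) {x : L} (hx : x ≠ 0)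
    (hint : ((x : L) : w.adicCompletion L) ∈ w.adicCompletionIntegers L) (hinv : ((x⁻¹ : L) : w.adicCompletion L) ∈ w.adicCompletionIntegers L) :
    Valued.v ((x : L) : w.adicCompletion L) = 1 := by
  rw [HeightOneSpectrum.mem_adicCompletionIntegers] at hint hinv
  have hx' : ((x : L) : w.adicCompletion L) ≠ 0 := by
    rw [← map_zero (algebraMap L (w.adicCompletion L))]
    exact fun h => hx ((algebraMap L (w.adicCompletion L)).injective (by rw [HeightOneSpectrum.algebraMap_adicCompletion]; exact h))
  have hinv' : (Valued.v ((x : L) : w.adicCompletion L))⁻¹ ≤ 1 := by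
    rwa [← map_inv₀, show (((x : L) : w.adicCompletion L))⁻¹ = ((x⁻¹ : L) : w.adicCompletion L) from
      (map_inv₀ (algebraMap L (w.adicCompletion L)) x).symm]
  exact le_antisymm hint ((inv_le_one₀ ((Valuation.pos_iff _).2 hx')).1 hinv')

/-- **`|ξ|_v = 1` FROM THE OFF-`U(S,h)` LETTERS** of ★ (x-a) `K2LiuSiegelEisensteinKindWLetters` §1 (`S` and `S⁻¹` integral above `v` — ★ `integral_of_not_mem_kindWPlaces`,
★ `inv_integral_of_not_mem_kindWPlaces`) for a non-zero SKEW line index, with `δ` a unit above `v` (★ (KW1-b2)'s `hδw`). [cite: CasselsFrohlichANT1967, Ch. II §10] [cite: Tate1950, §2.2] -/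
theorem normAbs_xi_eq_one_of_integral {τ : LocalRing L v → v.adicCompletion (Fp L)}
    (hτ : ∀ r, toLocalRing L v (τ r) = r + conjLocal L (IsCMField.complexConj L) v r)
    (S : Matrix (Fin 1) (Fin 1) L) (hSσ : IsCMField.complexConj L (S 0 0) = -S 0 0) (hS0 : S 0 0 ≠ 0)
    (hint : ∀ (w : UnitaryGroup.PlacesOver L v) (i j : Fin 1), ((S i j : L) : w.1.adicCompletion L) ∈ w.1.adicCompletionIntegers L)
    (hinv : ∀ (w : UnitaryGroup.PlacesOver L v) (i j : Fin 1), ((S⁻¹ i j : L) : w.1.adicCompletion L) ∈ w.1.adicCompletionIntegers L)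
    (hδw : ∀ w : UnitaryGroup.PlacesOver L v, Valued.v ((imagUnit L : L) : w.1.adicCompletion L) = 1) :
    normAbs (v.adicCompletion (Fp L)) (τ (⅟(2 : LocalRing L v) * algebraMap L (LocalRing L v) (S 0 0) * algebraMap L (LocalRing L v) (imagUnit L))) = 1 := by
  obtain ⟨w⟩ := (inferInstance : Nonempty (UnitaryGroup.PlacesOver L v))
  refine normAbs_xi_eq_one L v hτ S hSσ w (valued_coe_eq_one_of_integral L w.1 hS0 (hint w 0 0) ?_) (hδw w)
  have h := hinv w 0 0
  rwa [inv_fin_one_apply] at h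

end Summit.HodgeConjecture.HodgeConjecture.Cruxes.HLiu418.K2LiuKindOneLineCharacterReading

end
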